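import Mathlib
import Summits.Ventures.PercRepro2.Defs
import Summits.Ventures.PercRepro2.Graph
import Summits.Ventures.PercRepro2.HullDefs
import Summits.Ventures.PercRepro2.LocRows
import Summits.Ventures.PercRepro2.SwRow
import Summits.Ventures.PercRepro2.SwAllRow

/-!
# The typed rigid row (blind cell PercRepro2, night-4 g6, 2026-08-24; proofs/NIGHT4-G6.md §13–§14)

Row 2′SW-ALL (`LocRows.SwAll`) asks for a permutation of `Q = {h ∉ H_l, o ∈ R_side(l)}` turning every
red edge inside `C_R(h)` blue.  Its TYPED form replaces the principal conditions on the clusters of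
`l` by arbitrary monotone ones: for an up-set `𝓤` and a down-set `𝓓` of vertex sets,
`typedQ = {h ∉ H_l, C_R(l) ∈ 𝓤, C_B(l) ∈ 𝓓}` and `TypedSwAll` asks for a rigid permutation of it.
`SwAll` is the case `𝓤 = {S ∣ o ∈ S}`, `𝓓 = {S ∣ o ∉ S}` (`swAll_of_typed`); `𝓤 = 𝓓 = univ` is
the colour swap (`typed_univ`).  Census: 0 Hall failures on all connected graphs with n ≤ 6 for all
`𝓤`, `𝓓` with at most two generators (407,830 cases at n = 6) and at n = 7 for m ≤ 9 (3,562,624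
cases); with the typed side ingredients (TypedRigidSide, TypedRigidOneSided) the typed row is the
statement closed under gluing at a cut vertex (NIGHT4-G6.md §14, paper).
-/

namespace Summit.Ventures.PercRepro2

namespace LocRows

open Hull

variable {V : Type*} {E : Type*} [Fintype E] [DecidableEq E]

open scoped Classical

variable (ends : E → Sym2 V)

/-- The typed class `{h ∉ H_l, C_R(l) ∈ 𝓤, C_B(l) ∈ 𝓓}`. -/
noncomputable def typedQ (l h : V) (𝓤 𝓓 : Set (Set V)) : Finset (Config E) :=
  Finset.univ.filter fun ζ =>
    h ∉ hull ends ζ l ∧ cluster ends ζ l ∈ 𝓤 ∧ cluster ends (blue ζ) l ∈ 𝓓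

/-- **The typed rigid row**: a rigid permutation of `typedQ`. -/
def TypedSwAll (l h : V) (𝓤 𝓓 : Set (Set V)) : Prop :=
  ∃ f : {ζ // ζ ∈ typedQ ends l h 𝓤 𝓓} → Config E, Function.Injective f ∧
    ∀ x, f x ∈ typedQ ends l h 𝓤 𝓓 ∧
      ∀ e, e ∈ within ends (cluster ends x.1 h) → x.1 e = true → f x e = false

/-- `Q` is the typed class at the principal pair `{S ∣ o ∈ S}`, `{S ∣ o ∉ S}`. -/
lemma typedQ_principal (l h o : V) :
    typedQ ends l h {S : Set V | o ∈ S} {S : Set V | o ∉ S} = tgtU ends l h {S : Set V | o ∈ S} := by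
  ext ζ
  simp only [typedQ, tgtU, Finset.mem_filter, Finset.mem_univ, true_and, Set.mem_setOf_eq]

/-- **The typed row at the principal pair is row 2′SW-ALL.** -/
theorem swAll_of_typed {l h o : V}
    (hT : TypedSwAll ends l h {S : Set V | o ∈ S} {S : Set V | o ∉ S}) : SwAll ends l h o := by
  obtain ⟨f, hf, hmem⟩ := hT
  have e := typedQ_principal ends l h o
  have hin : ∀ x : {ζ // ζ ∈ tgtU ends l h {S : Set V | o ∈ S}},
      x.1 ∈ typedQ ends l h {S : Set V | o ∈ S} {S : Set V | o ∉ S} := fun x => by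
    rw [e]; exact x.2
  refine ⟨fun x => f ⟨x.1, hin x⟩, ?_, fun x => ?_⟩
  · intro x y hxy
    have h1 : (⟨x.1, hin x⟩ : {ζ // ζ ∈ typedQ ends l h {S : Set V | o ∈ S} {S : Set V | o ∉ S}}).1 =
        (⟨y.1, hin y⟩ : {ζ // ζ ∈ typedQ ends l h {S : Set V | o ∈ S} {S : Set V | o ∉ S}}).1 :=
      congrArg Subtype.val (hf hxy)
    exact Subtype.ext h1
  · obtain ⟨h1, h2⟩ := hmem ⟨x.1, hin x⟩
    refine ⟨?_, h2⟩
    simp only [typedQ, Finset.mem_filter, Finset.mem_univ, true_and, Set.mem_setOf_eq] at h1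
    simp only [tgtU, Finset.mem_filter, Finset.mem_univ, true_and, Set.mem_setOf_eq]
    exact h1

/-- **The typed row at `𝓤 = 𝓓 = univ` is the colour swap**: the class `{h ∉ H_l}` is swap-invariant
and the swap turns every red edge blue. -/
theorem typed_univ (l h : V) : TypedSwAll ends l h Set.univ Set.univ := by
  refine ⟨fun x => blue x.1, ?_, fun x => ⟨?_, fun e _ hred => ?_⟩⟩
  · intro x y hxy
    have := congrArg blue hxy
    simp only [blue_blue] at this
    exact Subtype.ext this
  · have hx := x.2
    simp only [typedQ, Finset.mem_filter, Finset.mem_univ, true_and, Set.mem_univ, and_true] at hx ⊢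
    rw [hull_blue]; exact hx
  · show blue x.1 e = false
    rw [blue_apply, hred]; rfl

/-- The typed row over all finite graphs, marks and monotone families. -/
def TypedSwAll_all : Prop :=
  ∀ (V E : Type) [Fintype V] [DecidableEq V] [Fintype E] [DecidableEq E] (ends : E → Sym2 V)
    (l h : V) (𝓤 𝓓 : Set (Set V)), IsUpperSet 𝓤 → IsLowerSet 𝓓 → TypedSwAll ends l h 𝓤 𝓓

/-- **The typed row on every graph gives row 2′SW-ALL on every graph**, hence (SW), 2′DOM, (BASE). -/
theorem swAll_all_of_typed_all (hT : TypedSwAll_all) : SwAll_all := by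
  intro V E _ _ _ _ ends l h o _ _ _
  refine swAll_of_typed ends (hT V E ends l h _ _ ?_ ?_)
  · intro S S' hSS' hS; exact hSS' hS
  · intro S S' hSS' hS hmem; exact hS (hSS' hmem)

/-- **The typed row on every graph gives row (SW) on every graph.** -/
theorem sw_all_of_typed_all (hT : TypedSwAll_all) : Sw_all :=
  sw_all_of_swAll_all (swAll_all_of_typed_all hT)

end LocRows

end Summit.Ventures.PercRepro2
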